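import Literature.NumberTheory.GaloisRepresentations.HomDualLocalPairingGlobal
import Literature.NumberTheory.GaloisRepresentations.IdeleLocalInvariantReadoutArch
import HarnessLib

/-!
# (R4), native local half at EVERY place (finite or infinite): the cup product of a local readout against a bidual class,
# pushed into `H²(Γ_{K_v}, K̄_vˣ)` by Kummer, is minus `h_*(δ₁ ·)`; at an INFINITE place the local Tate pairing of the readout
# IS door-c5's archimedean idèle invariant of any class with the same readout (Milne *ADT* I Thm. 4.10 (proof), Ex. 1.6 (c))

Topic `NumberTheory/GaloisRepresentations`; namespace `Literature.NumberTheory.GaloisRepresentations.HomDual`.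
One definition with body (`muPlaceIso`, the isomorphism `μₙ(K̄)|_{Γ_{K_v}} ≅ μₙ(K̄_v)` at an ARBITRARY place `v`, literally the
construction of the finite-place `muLocalIso` of `LocalGlobalCohomologyTateProofs.lean` with `v.adicCompletion K` replaced by
`Place.Completion v`) and theorems; no instance, no named fact, no notation, no `sorry`.  Sequel to door-c6 g17's
`HomDualLocalPairing` / `HomDualLocalPairingGlobal` (the FINITE places, where the conclusion is an identity with
`brauerInvariantEquiv K_v`) and to `IdeleLocalInvariantReadoutArch` (door-c4 g18: the idèle side at the INFINITE places).

THE STATEMENTS.  Let `K` be a number field, `v` ANY place, `K_v = Place.Completion v`, `ρ` a finite `n`-torsion discrete Galois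
module on `M` with its canonical presentation `0 → N₁ → P → M → 0` (`FreePresentation.presentationComplex ρ`),
`h : N₁ → K̄_vˣ` a `Γ_{K_v}`-equivariant homomorphism, `κ : M^{DD} → M` an equivariant map with `Φ f = f (κ Φ)`.

* §1 `muPlaceIso v n`, `cohomologyMap_muPlaceIso_kummer_injective` (Hilbert 90: `H²(K_v, μₙ|) ↪ H²(K_v, K̄_vˣ)` at every place).
* §2 `kummer_muPlaceIso_tateDualPairingLocal_eq` (the morphism of pairings `(e, κ, kummerι ∘ muPlaceIso)`), and the EXACT identity
  **`cohomologyMap_kummer_localTatePairing_localReadout`**: in `H²(Γ_{K_v}, K̄_vˣ)`,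
  `H²(kummerι ∘ muPlaceIso)(localReadout h ∪ y) = − h_*(δ₁^{K_v}(H¹(κ) y))` for every `y ∈ H¹(K_v, M^{DD})` — steps 2–3 of door-c6's
  `zmodToQmodZ_localTatePairingZMod_localReadout`, which are place-independent (`ContPairing.cupProduct_map`, F7-cup
  `cupProduct_dualδ₀_eq_neg`); hence **`localTatePairing_localReadout_eq_zero_iff`** (`localReadout h ∪ y = 0 ↔ h_*(δ₁(H¹κ y)) = 0`)
  and its GLOBAL form **`localTatePairing_localReadout_res_eq_zero_iff`** (`y = loc_v (H¹(ι) x)`: `… ↔ h_*(res_v (δ₁^K x)) = 0`,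
  by `res_δ₁_presentation`, `map_map_res_eq_res`).
* §3 (INFINITE `w`) `two_nsmul_zmodToQmodZ_localTatePairingZMod_inl` (the local Tate pairing through THE canonical family at `w` is
  `2`-torsion: `canonical (inl w) = archimedeanInvariantMap`), and the archimedean dictionary for the pairing step (R4):
  **`localInvInf_H2π_eq_zmodToQmodZ_localTatePairingZMod_localReadout`** — for a finite Galois layer `E/K`, a `2`-cocycle `b` of
  `Gal(E/K)` in `J_E` and `x ∈ H¹(K, M)`: IF (at a real `w`) the class of `b` read out through door-c5's archimedean readout pair
  vanishes exactly when `h_*(res_w (δ₁^K x))` does (the TRANSPORT hypothesis — the archimedean copy of the finite-place transport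
  identity `[pull_{readoutPair} β] = (π_v ∘ f)_* res_v δ₁ x` of the presentation road, in its weakest usable form), THEN
  `localInvInf E w [b] = zmodToQmodZ n ⟨localReadout h, loc_w (H¹(ι) x)⟩_w` (and `= −` the same, both sides being `2`-torsion):
  the infinite-place term of the E-side sum `inv E β = Σ_v localInv E v β + Σ_w localInvInf E w β` IS the infinite-place term of the
  reciprocity sum of `poitouTate_selmerStructure_duality_of_globalTerms_of_imp`.  At a complex `w` no hypothesis is needed.

HONEST FRAMING: no case of Poitou–Tate or BSD is proved here; (R4)(e) of the presentation road (crux `stmt-BirchSwinnertonDyer-19295`,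
FINDING-door-c6-g17 §2) for base fields WITH real places, modulo the displayed transport hypothesis.

## References
* J. S. Milne, *Arithmetic Duality Theorems* (2nd ed. 2006), I Thm. 4.10 (proof, p. 58), I Lemma 4.13, I Ex. 1.6 (c), I Thm. 2.13.
  [MilneADT2006]
* J. Neukirch, A. Schmidt, K. Wingberg, *Cohomology of Number Fields* (2008), (1.4.2)–(1.5.2), (8.1.17). [NeukirchSchmidtWingberg2008]
* J.-P. Serre, *Galois Cohomology* (1997), II §1.2 (Kummer theory, Hilbert 90). [SerreGaloisCohomology1997]
* J. W. S. Cassels, A. Fröhlich (eds.), *Algebraic Number Theory* (1967), Ch. VII §7.3 Cor. 7.4 (b), §11.2. [CasselsFrohlichANT1967]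
-/

noncomputable section

open CategoryTheory NumberField IsDedekindDomain groupCohomology
open Field (absoluteGaloisGroup)
open Literature.NumberTheory.Automorphic (IdeleClassGroup.ideleRep)
open scoped ContRepresentation

namespace Literature.NumberTheory.GaloisRepresentations

namespace HomDual

open Literature.Algebra.Homology Literature.Algebra.Homology.DiscreteRep DiscreteGaloisModule IdeleClassBar
  FreePresentation DGMBridge Literature.NumberTheory.GaloisCohomology
  Literature.AnabelianGeometry.AbsoluteAnabelian.Prop121vii

-- explicit cocycles / `δ₁` / cup products need `LocallyCompactSpace Γ`; the tree's `absoluteGaloisGroup_compactSpace` is the source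
-- (local, no override; as in `HomDualLocalPairingGlobal.lean`).
attribute [local instance] absoluteGaloisGroup_compactSpace

variable {K : Type} [Field K] [NumberField K]

/-! ## §1 `μₙ(K̄)|_{Γ_{K_v}} ≅ μₙ(K̄_v)` at an arbitrary place, and Kummer injectivity -/

section Mu

variable (v : Place K) (n : ℕ) [NeZero n]

/-- **`μₙ(K̄)|_{Γ_{K_v}} ≅ μₙ(K̄_v)`** as discrete `Γ_{K_v}`-modules at an ARBITRARY place `v` of `K` (`K_v = Place.Completion v`;
the tree's `(mu K n).toLocal v` is definitionally the source; at a finite place this is literally `muLocalIso`).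
[cite: MilneADT2006, I §1, I §4] -/
def muPlaceIso :
    ((mu K n).restrict (absGaloisRestrict K (Place.Completion v))).toTopRep ≅ (mu (Place.Completion v) n).toTopRep :=
  haveI : CharZero (Place.Completion v) := charZero_of_algebra (K := K) (Place.Completion v)
  topRepIsoOfEquiv (X := ((mu K n).restrict (absGaloisRestrict K (Place.Completion v))).toTopRep)
    (Y := (mu (Place.Completion v) n).toTopRep)
    { (muTransferEquiv K (Place.Completion v) n).toIntLinearEquiv with
      continuous_toFun := continuous_of_discreteTopology
      continuous_invFun := continuous_of_discreteTopology }
    fun σ x => muTransfer_mu K (Place.Completion v) n σ x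

/-- At a finite place `muPlaceIso (inr v) = muLocalIso v` (same construction). [cite: MilneADT2006, I §1] -/
theorem muPlaceIso_inr (v : HeightOneSpectrum (𝓞 K)) : muPlaceIso (Sum.inr v : Place K) n = muLocalIso v n := rfl

/-- **Kummer injectivity at every place: `H²(Γ_{K_v}, μₙ(K̄)|) ↪ H²(Γ_{K_v}, K̄_vˣ)`** (`muPlaceIso` is an isomorphism, and
`H²(kummerι)` is injective by Hilbert 90, `kummer_injective`). [cite: SerreGaloisCohomology1997, II §1.2] -/
theorem cohomologyMap_muPlaceIso_kummer_injective :
    Function.Injective (cohomologyMap ((muPlaceIso v n).hom ≫ kummerι (Place.Completion v) n) 2) := by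
  intro a b h
  rw [cohomologyMap_comp_apply, cohomologyMap_comp_apply] at h
  exact (continuousCohomologyEquivOfIso (muPlaceIso v n) 2).injective (kummer_injective (Place.Completion v) n h)

end Mu

/-! ## §2 The cup product of a local readout in `H²(Γ_{K_v}, K̄_vˣ)`, at every place -/

section Readout

variable {M : Type} [AddCommGroup M] [TopologicalSpace M] [DiscreteTopology M] [Finite M]
variable (ρ : DiscreteGaloisModule K M) (n : ℕ) [NeZero n]

/-- **The morphism of pairings `(e, κ, kummerι ∘ muPlaceIso)`** from `M^D|_v × M^{DD}|_v → μₙ(K̄)|_v` to the evaluation pairing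
`Hom_ℤ(M|_v, K̄_vˣ) × M|_v → K̄_vˣ` at an arbitrary place `v`: `ι_v(Φ f) = (e f)(κ Φ)` as soon as `Φ f = f (κ Φ)`.
[cite: MilneADT2006, I §0][cite: NeukirchSchmidtWingberg2008, (1.4.2)] -/
theorem kummer_muPlaceIso_tateDualPairingLocal_eq [Finite (TateDual K M n)] (hM : ∀ m : M, n • m = 0) (v : Place K)
    [CharZero (Place.Completion v)]
    (κ : ((ρ.tateDual n).tateDual n).toContRepresentation →ⁱL ρ.toContRepresentation)
    (hκ : ∀ (Φ : TateDual K (TateDual K M n) n) (f : TateDual K M n), Φ f = f (κ Φ))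
    (f : TateDual K M n) (Φ : TateDual K (TateDual K M n) n) :
    ((muPlaceIso v n).hom ≫ kummerι (Place.Completion v) n).hom
        ((tateDualPairingLocal (ρ.tateDual n) n v).toLin f Φ) =
      (evalPairing (ρ.restrictField (Place.Completion v)) (units (Place.Completion v))).toLin
        ((tateDualRestrictUnitsIso K (Place.Completion v) ρ n hM).hom.hom f)
        ((toTopRepHom (((ρ.tateDual n).tateDual n).restrictField (Place.Completion v))
          (ρ.restrictField (Place.Completion v)) (κ.restrictField (Place.Completion v))).hom Φ) := by
  apply unitsVal_injective (Place.Completion v)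
  change unitsVal (Place.Completion v) (kummerInclAddHom (Place.Completion v) n
      (muTransfer K (Place.Completion v) n (Φ f))) =
    unitsVal (Place.Completion v) ((show M →ₗ[ℤ] UnitsCarrier (Place.Completion v) from
      (tateDualRestrictUnitsIso K (Place.Completion v) ρ n hM).hom.hom f) (κ Φ))
  rw [unitsVal_kummerInclAddHom, muVal_muTransfer, unitsVal_tateDualRestrictUnitsIso_hom_apply, hκ]

/-- **(R4), native local half at EVERY place, in `H²(Γ_{K_v}, K̄_vˣ)`.**  For a `Γ_{K_v}`-equivariant `h : N₁ → K̄_vˣ` out of the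
relation module of the canonical presentation of the finite `n`-torsion module `ρ`, an inverse-of-biduality `κ : M^{DD} → M`
(`Φ f = f (κ Φ)`), and `y ∈ H¹(K_v, M^{DD})`:
`H²(kummerι ∘ muPlaceIso)(localReadout h ∪ y) = − h_*(δ₁^{K_v}(H¹(κ) y))`, where `∪` is the cup product of
`M^D|_v × M^{DD}|_v → μₙ|_v` (`localTatePairing (ρ.tateDual n) n v`), `δ₁^{K_v}` the connecting map of the restricted presentation.
(At a finite place, composing with `brauerInvariantEquiv K_v` gives door-c6's `zmodToQmodZ_localTatePairingZMod_localReadout`.)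
[cite: MilneADT2006, I Thm. 4.10 (proof, p. 58)][cite: NeukirchSchmidtWingberg2008, (1.4.2)–(1.4.4)] -/
theorem cohomologyMap_kummer_localTatePairing_localReadout [Finite (TateDual K M n)] (hM : ∀ m : M, n • m = 0) (v : Place K)
    [CharZero (Place.Completion v)]
    (κ : ((ρ.tateDual n).tateDual n).toContRepresentation →ⁱL ρ.toContRepresentation)
    (hκ : ∀ (Φ : TateDual K (TateDual K M n) n) (f : TateDual K M n), Φ f = f (κ Φ))
    (h : (haveI := moduleFinite_presModule₁ ρ
      (homGaloisModule ((presModule₁ ρ).restrictField (Place.Completion v)) (units (Place.Completion v))).toTopRep.ρ.invariants))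
    (y : galoisCohomology (((ρ.tateDual n).tateDual n).restrictField (Place.Completion v)) 1) :
    cohomologyMap ((muPlaceIso v n).hom ≫ kummerι (Place.Completion v) n) 2
        (localTatePairing (ρ.tateDual n) n v (localReadout ρ n hM (Place.Completion v) h) y) =
      - (haveI := moduleFinite_presModule₁ ρ
         haveI := moduleFinite_presModule₂ ρ
         cohomologyMap (toTopRepHom ((presModule₁ ρ).restrictField (Place.Completion v)) (units (Place.Completion v))
            (equivariantMap ((presModule₁ ρ).restrictField (Place.Completion v)) (units (Place.Completion v)) h)) 2
          ((isSES_restrict (presModule₁ ρ) (presModule₂ ρ) ρ (pres_isSES ρ) (K' := Place.Completion v)).δ₁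
            (galoisCohomology.map (κ.restrictField (Place.Completion v)) 1 y))) := by
  haveI := moduleFinite_presModule₁ ρ
  haveI := moduleFinite_presModule₂ ρ
  change cohomologyMap ((muPlaceIso v n).hom ≫ kummerι (Place.Completion v) n) 2
      ((tateDualPairingLocal (ρ.tateDual n) n v).cupProduct (localReadout ρ n hM (Place.Completion v) h) y) = _
  -- Step 2: morphism of pairings ⟹ `H²(γ)(e⁻¹δ₀h ∪ y) = δ₀h ∪ H¹(κ)y`
  erw [ContPairing.cupProduct_map (tateDualPairingLocal (ρ.tateDual n) n v)
    (evalPairing (ρ.restrictField (Place.Completion v)) (units (Place.Completion v)))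
    (tateDualRestrictUnitsIso K (Place.Completion v) ρ n hM).hom
    (toTopRepHom (((ρ.tateDual n).tateDual n).restrictField (Place.Completion v))
      (ρ.restrictField (Place.Completion v)) (κ.restrictField (Place.Completion v)))
    ((muPlaceIso v n).hom ≫ kummerι (Place.Completion v) n)
    (kummer_muPlaceIso_tateDualPairingLocal_eq ρ n hM v κ hκ)]
  -- Step 3: `H¹(e)(localReadout h) = δ₀ h`, then F7-cup
  change (evalPairing (ρ.restrictField (Place.Completion v)) (units (Place.Completion v))).cupProduct
      (cohomologyMap (tateDualRestrictUnitsIso K (Place.Completion v) ρ n hM).hom 1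
        (cohomologyMap (tateDualRestrictUnitsIso K (Place.Completion v) ρ n hM).inv 1
          (dualδ₀ ((presModule₁ ρ).restrictField (Place.Completion v))
            ((presModule₂ ρ).restrictField (Place.Completion v)) (ρ.restrictField (Place.Completion v))
            (units (Place.Completion v))
            (restrictIntertwining (presModule₁ ρ) (presModule₂ ρ) (presIncl ρ))
            (restrictIntertwining (presModule₂ ρ) ρ (presProj ρ))
            (isSES_restrict (presModule₁ ρ) (presModule₂ ρ) ρ (pres_isSES ρ))
            (baer_unitsCarrier (Place.Completion v)) h)))
      (galoisCohomology.map (κ.restrictField (Place.Completion v)) 1 y) = _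
  rw [cohomologyMap_tateDualRestrictUnitsIso_hom_inv_apply, cupProduct_dualδ₀_eq_neg]

/-- **`localReadout h ∪ y = 0 ↔ h_*(δ₁^{K_v}(H¹(κ) y)) = 0`** in degree `2`, at every place (Kummer injectivity).
[cite: MilneADT2006, I Thm. 4.10 (proof, p. 58)][cite: SerreGaloisCohomology1997, II §1.2] -/
theorem localTatePairing_localReadout_eq_zero_iff [Finite (TateDual K M n)] (hM : ∀ m : M, n • m = 0) (v : Place K)
    [CharZero (Place.Completion v)]
    (κ : ((ρ.tateDual n).tateDual n).toContRepresentation →ⁱL ρ.toContRepresentation)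
    (hκ : ∀ (Φ : TateDual K (TateDual K M n) n) (f : TateDual K M n), Φ f = f (κ Φ))
    (h : (haveI := moduleFinite_presModule₁ ρ
      (homGaloisModule ((presModule₁ ρ).restrictField (Place.Completion v)) (units (Place.Completion v))).toTopRep.ρ.invariants))
    (y : galoisCohomology (((ρ.tateDual n).tateDual n).restrictField (Place.Completion v)) 1) :
    localTatePairing (ρ.tateDual n) n v (localReadout ρ n hM (Place.Completion v) h) y = 0 ↔
      (haveI := moduleFinite_presModule₁ ρ
       haveI := moduleFinite_presModule₂ ρ
       cohomologyMap (toTopRepHom ((presModule₁ ρ).restrictField (Place.Completion v)) (units (Place.Completion v))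
            (equivariantMap ((presModule₁ ρ).restrictField (Place.Completion v)) (units (Place.Completion v)) h)) 2
          ((isSES_restrict (presModule₁ ρ) (presModule₂ ρ) ρ (pres_isSES ρ) (K' := Place.Completion v)).δ₁
            (galoisCohomology.map (κ.restrictField (Place.Completion v)) 1 y))) = 0 := by
  haveI := moduleFinite_presModule₁ ρ
  haveI := moduleFinite_presModule₂ ρ
  have key := cohomologyMap_kummer_localTatePairing_localReadout ρ n hM v κ hκ h y
  constructor
  · intro h0
    rw [h0] at key
    have hz : cohomologyMap ((muPlaceIso v n).hom ≫ kummerι (Place.Completion v) n) 2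
        (0 : galoisCohomology ((mu K n).toLocal v) 2) = 0 := map_zero _
    rw [hz] at key
    exact neg_eq_zero.mp key.symm
  · intro h0
    apply cohomologyMap_muPlaceIso_kummer_injective v n
    rw [key, h0, neg_zero]
    exact (map_zero _).symm

/-- **Global form**: for `x ∈ H¹(K, M)` and a biduality pair `(ι, κ)` (`κ ∘ ι = id`, `Φ f = f (κ Φ)`),
`localReadout h ∪ loc_v (H¹(ι) x) = 0 ↔ h_*(res_v (δ₁^K x)) = 0` at every place `v` (`res_v ∘ δ₁^K = δ₁^{K_v} ∘ res_v`,
`H¹(κ)(res (H¹(ι) x)) = res x`). [cite: MilneADT2006, I Thm. 4.10 (proof, p. 58)][cite: NeukirchSchmidtWingberg2008, (1.5.2)] -/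
theorem localTatePairing_localReadout_res_eq_zero_iff [Finite (TateDual K M n)] (hM : ∀ m : M, n • m = 0) (v : Place K)
    [CharZero (Place.Completion v)]
    (ι : ρ.toContRepresentation →ⁱL ((ρ.tateDual n).tateDual n).toContRepresentation)
    (κ : ((ρ.tateDual n).tateDual n).toContRepresentation →ⁱL ρ.toContRepresentation)
    (hκι : ∀ m : M, κ (ι m) = m)
    (hκ : ∀ (Φ : TateDual K (TateDual K M n) n) (f : TateDual K M n), Φ f = f (κ Φ))
    (h : (haveI := moduleFinite_presModule₁ ρ
      (homGaloisModule ((presModule₁ ρ).restrictField (Place.Completion v)) (units (Place.Completion v))).toTopRep.ρ.invariants))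
    (x : galoisCohomology ρ 1) :
    localTatePairing (ρ.tateDual n) n v (localReadout ρ n hM (Place.Completion v) h)
        (galoisCohomology.res ((ρ.tateDual n).tateDual n) (Place.Completion v) 1 (galoisCohomology.map ι 1 x)) = 0 ↔
      (haveI := moduleFinite_presModule₁ ρ
       cohomologyMap (toTopRepHom ((presModule₁ ρ).restrictField (Place.Completion v)) (units (Place.Completion v))
            (equivariantMap ((presModule₁ ρ).restrictField (Place.Completion v)) (units (Place.Completion v)) h)) 2
          (galoisCohomology.res (presModule₁ ρ) (Place.Completion v) 2 ((pres_isSES ρ).δ₁ x))) = 0 := by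
  haveI := moduleFinite_presModule₁ ρ
  haveI := moduleFinite_presModule₂ ρ
  rw [localTatePairing_localReadout_eq_zero_iff ρ n hM v κ hκ h, map_map_res_eq_res ρ ι κ hκι,
    res_δ₁_presentation ρ (Place.Completion v) x]

end Readout

/-! ## §3 The infinite places: the local Tate pairing of a readout IS door-c5's archimedean idèle invariant -/

section Infinite

variable {M : Type} [AddCommGroup M] [TopologicalSpace M] [DiscreteTopology M] [Finite M]
variable (ρ : DiscreteGaloisModule K M) (n : ℕ) [NeZero n]

/-- **The local Tate pairing at an infinite place through THE canonical family is `2`-torsion in `ℚ/ℤ`**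
(`canonical (inl w) = archimedeanInvariantMap`, valued in `{0, n/2}`). [cite: MilneADT2006, I Ex. 1.6 (c), I Thm. 2.13] -/
theorem two_nsmul_zmodToQmodZ_localTatePairingZMod_inl [Finite (TateDual K M n)] (w : InfinitePlace K)
    (a : galoisCohomology ((ρ.tateDual n).toLocal (Sum.inl w)) 1)
    (y : galoisCohomology (((ρ.tateDual n).tateDual n).toLocal (Sum.inl w)) 1) :
    2 • zmodToQmodZ n (localTatePairingZMod (ρ.tateDual n) n (Sum.inl w) (LocalInvariants.canonical K n (Sum.inl w)) a y) = 0 := by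
  rw [← map_nsmul, localTatePairingZMod_apply, LocalInvariants.canonical_inl, two_nsmul_archimedeanInvariantMap, map_zero]

variable {E : Type} [Field E] [NumberField E] [Algebra K E] [IsGalois K E]

/-- **THE ARCHIMEDEAN DICTIONARY FOR THE PAIRING STEP (R4).**  Let `E/K` be a finite Galois layer (`ιE : E → K̄`), `w` an infinite
place of `K`, `b` a `2`-cocycle of `Gal(E/K)` in `J_E`, `h : N₁ → K̄_wˣ` a `Γ_{K_w}`-equivariant homomorphism out of the relation module
of the canonical presentation of the finite `n`-torsion `ρ`, `(ι, κ)` a biduality pair and `x ∈ H¹(K, M)`.  IF at a real `w` the class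
`[pull_{archReadoutPair} b] ∈ H²(Γ_{K_w}, K̄_wˣ)` vanishes exactly when `h_*(res_w (δ₁^K x))` does (transport hypothesis), THEN
`localInvInf E w [b] = zmodToQmodZ n ⟨localReadout h, loc_w (H¹(ι) x)⟩_w`, the local Tate pairing through THE canonical family
(both sides are `2`-torsion and vanish simultaneously; at a complex `w` both vanish outright).
[cite: MilneADT2006, I Thm. 4.10 (proof, p. 58), I Ex. 1.6 (c)][cite: CasselsFrohlichANT1967, Ch. VII §7.3 Cor. 7.4 (b), §11.2] -/
theorem localInvInf_H2π_eq_zmodToQmodZ_localTatePairingZMod_localReadout [Finite (TateDual K M n)] [Fintype (E ≃ₐ[K] E)]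
    (hM : ∀ m : M, n • m = 0) (w : InfinitePlace K) (ιE : E →ₐ[K] AlgebraicClosure K)
    (b : cocycles₂ (IdeleClassGroup.ideleRep K E))
    (ι : ρ.toContRepresentation →ⁱL ((ρ.tateDual n).tateDual n).toContRepresentation)
    (κ : ((ρ.tateDual n).tateDual n).toContRepresentation →ⁱL ρ.toContRepresentation)
    (hκι : ∀ m : M, κ (ι m) = m)
    (hκ : ∀ (Φ : TateDual K (TateDual K M n) n) (f : TateDual K M n), Φ f = f (κ Φ))
    (h : (haveI := moduleFinite_presModule₁ ρ
      (homGaloisModule ((presModule₁ ρ).restrictField w.Completion) (units w.Completion)).toTopRep.ρ.invariants))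
    (x : galoisCohomology ρ 1)
    (htransport : w.IsReal →
      (twoCocycleClass (units w.Completion).toTopRep ((IdeleCohomology.archReadoutPair w ιE).pull b) = 0 ↔
        (haveI := moduleFinite_presModule₁ ρ
         cohomologyMap (toTopRepHom ((presModule₁ ρ).restrictField w.Completion) (units w.Completion)
              (equivariantMap ((presModule₁ ρ).restrictField w.Completion) (units w.Completion) h)) 2
            (galoisCohomology.res (presModule₁ ρ) w.Completion 2 ((pres_isSES ρ).δ₁ x))) = 0)) :
    IdeleCohomology.localInvInf E w (H2π _ b) =
      zmodToQmodZ n (localTatePairingZMod (ρ.tateDual n) n (Sum.inl w) (LocalInvariants.canonical K n (Sum.inl w))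
        (haveI : CharZero w.Completion := charZero_of_algebra (K := K) w.Completion
         localReadout ρ n hM w.Completion h)
        (galoisCohomology.res ((ρ.tateDual n).tateDual n) w.Completion 1 (galoisCohomology.map ι 1 x))) := by
  haveI : CharZero w.Completion := charZero_of_algebra (K := K) w.Completion
  haveI : CharZero (Place.Completion (Sum.inl w : Place K)) := charZero_of_algebra (K := K) w.Completion
  haveI := moduleFinite_presModule₁ ρ
  rw [localTatePairingZMod_apply]
  refine IdeleCohomology.localInvInf_H2π_eq_zmodToQmodZ_canonical_of_iff w ιE b _ fun hw => (htransport hw).trans ?_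
  exact (localTatePairing_localReadout_res_eq_zero_iff ρ n hM (Sum.inl w) ι κ hκι hκ h x).symm

/-- The same with a sign: `localInvInf E w [b] = − zmodToQmodZ n ⟨localReadout h, loc_w (H¹(ι) x)⟩_w` (the pairing value is `2`-torsion),
the shape of the finite-place terms `− inv_v(…)` of the reciprocity sum. [cite: MilneADT2006, I Thm. 4.10 (proof, p. 58), I Ex. 1.6 (c)] -/
theorem localInvInf_H2π_eq_neg_zmodToQmodZ_localTatePairingZMod_localReadout [Finite (TateDual K M n)] [Fintype (E ≃ₐ[K] E)]
    (hM : ∀ m : M, n • m = 0) (w : InfinitePlace K) (ιE : E →ₐ[K] AlgebraicClosure K)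
    (b : cocycles₂ (IdeleClassGroup.ideleRep K E))
    (ι : ρ.toContRepresentation →ⁱL ((ρ.tateDual n).tateDual n).toContRepresentation)
    (κ : ((ρ.tateDual n).tateDual n).toContRepresentation →ⁱL ρ.toContRepresentation)
    (hκι : ∀ m : M, κ (ι m) = m)
    (hκ : ∀ (Φ : TateDual K (TateDual K M n) n) (f : TateDual K M n), Φ f = f (κ Φ))
    (h : (haveI := moduleFinite_presModule₁ ρ
      (homGaloisModule ((presModule₁ ρ).restrictField w.Completion) (units w.Completion)).toTopRep.ρ.invariants))
    (x : galoisCohomology ρ 1)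
    (htransport : w.IsReal →
      (twoCocycleClass (units w.Completion).toTopRep ((IdeleCohomology.archReadoutPair w ιE).pull b) = 0 ↔
        (haveI := moduleFinite_presModule₁ ρ
         cohomologyMap (toTopRepHom ((presModule₁ ρ).restrictField w.Completion) (units w.Completion)
              (equivariantMap ((presModule₁ ρ).restrictField w.Completion) (units w.Completion) h)) 2
            (galoisCohomology.res (presModule₁ ρ) w.Completion 2 ((pres_isSES ρ).δ₁ x))) = 0)) :
    IdeleCohomology.localInvInf E w (H2π _ b) =
      - zmodToQmodZ n (localTatePairingZMod (ρ.tateDual n) n (Sum.inl w) (LocalInvariants.canonical K n (Sum.inl w))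
        (haveI : CharZero w.Completion := charZero_of_algebra (K := K) w.Completion
         localReadout ρ n hM w.Completion h)
        (galoisCohomology.res ((ρ.tateDual n).tateDual n) w.Completion 1 (galoisCohomology.map ι 1 x))) := by
  haveI : CharZero w.Completion := charZero_of_algebra (K := K) w.Completion
  rw [localInvInf_H2π_eq_zmodToQmodZ_localTatePairingZMod_localReadout ρ n hM w ιE b ι κ hκι hκ h x htransport, eq_neg_iff_add_eq_zero,
    ← two_nsmul]
  exact two_nsmul_zmodToQmodZ_localTatePairingZMod_inl ρ n w _ _

end Infinite

end HomDual

end Literature.NumberTheory.GaloisRepresentations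

end
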